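import Literature.AlgebraicGeometry.Motives.ComplexPointsSubmersion
import Literature.Geometry.Kaehler.RiemannSurfaceSeparating
import Mathlib.Topology.Covering.Basic
import HarnessLib

/-!
# The Riemann surface structure on a covering of the complex points of a smooth curve

Layer `Literature/AlgebraicGeometry/FundamentalGroup`, an input of the curve case of Riemann's
existence theorem (SGA1 XII Thm. 5.1; the complex structure on `X'` for `X' → X^an` a finite
covering, SGA1 XII §5 / Serre, GAGA §2 n°5). Let `S` be a `ℂ`-scheme, locally of finite type and
smooth of relative dimension `1`, and `q : T → S(ℂ)` a local homeomorphism (e.g. a covering map)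
to its complex points with the strong topology. The tree's holomorphic ALGEBRAIC CHARTS
`ComplexPoints.algebraicChart S 1 P : S(ℂ) ⇀ ℂ¹` (Serre, GAGA §2 n°5 Prop. 2; regular coordinates,
all regular functions holomorphic in them, `ComplexPoints.algebraicChart_spec`) read through
`ℂ¹ ≃ ℂ` and composed with the local inverses of `q` give charts `T ⇀ ℂ`:

* `algChart S P : S(ℂ) ⇀ ℂ`, `curveChart S hq t : T ⇀ ℂ` and the charted space
  `CurveCharts.chartedSpace S hq : ChartedSpace ℂ T` (a `def`; install with `letI`);
* `CurveCharts.isManifold` — **`T` is a Riemann surface**: the transition maps are regular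
  coordinates read in an algebraic chart (two local inverses of `q` cancel), hence holomorphic;
* `contDiffOn_evalOrZero_comp_symm`, `mdifferentiableAt_evalOrZero_comp` — **regular functions
  pulled back along `q` are holomorphic** on `T`; `q_curveChart_symm` — the chart formula
  `q ∘ (curveChart t)⁻¹ = (algChart (q t))⁻¹`;
* `neBot_nhdsNE` — a space with `ℂ`-charts has no isolated points (Hausdorffness of the total space
  of a covering of a Hausdorff space is the tree's `Literature.Topology.FourManifolds.t2Space_of_isCoveringMap`).

Everything is proved; the definitions are the charts and the charted-space structure.

## References

* J.-P. Serre, *Géométrie algébrique et géométrie analytique*, Ann. Inst. Fourier 6 (1956), §2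
  n°5 Prop. 2. [SerreGAGA1956]
* A. Grothendieck, M. Raynaud, *SGA 1*, Exp. XII §1, Thm. 5.1. [SGA1]
* O. Forster, *Lectures on Riemann Surfaces*, GTM 81 (1981), §1 Thm. 1.13 (pull-back of a complex
  structure along a local homeomorphism; cf. §4 Thm. 4.6). [Forster1981]
-/

noncomputable section

open scoped Manifold ContDiff Topology
open CategoryTheory AlgebraicGeometry Set Filter Function
open Literature.AlgebraicGeometry.Motives
open Literature.AlgebraicGeometry.Motives.AlgPoints (evalOrZero evalOrZero_of_mem)
open Literature.Geometry.Kaehler.RiemannSurface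

namespace Literature.AlgebraicGeometry.FundamentalGroup

namespace CurveCharts

/-! ### `ℂ¹ ≃ ℂ` and the algebraic charts read in `ℂ` -/

/-- The continuous linear identification `ℂ¹ = (Fin 1 → ℂ) ≃ ℂ`. [folklore] -/
def lineCLE : (Fin 1 → ℂ) ≃L[ℂ] ℂ := ContinuousLinearEquiv.funUnique (Fin 1) ℂ ℂ

/-- `ℂ¹ ≃ ℂ` is evaluation at the unique index. [folklore] -/
@[simp] theorem lineCLE_apply (v : Fin 1 → ℂ) : lineCLE v = v 0 := by
  simp [lineCLE, ContinuousLinearEquiv.coe_funUnique, Fin.default_eq_zero]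

/-- The inverse of `ℂ¹ ≃ ℂ` is the constant vector. [folklore] -/
@[simp] theorem lineCLE_symm_apply (z : ℂ) (i : Fin 1) : lineCLE.symm z i = z := by
  simp [lineCLE, ContinuousLinearEquiv.coe_funUnique_symm]

/-- The inverse of `ℂ¹ ≃ ℂ` is the constant vector (function form). [folklore] -/
theorem lineCLE_symm_eq (z : ℂ) : lineCLE.symm z = fun _ ↦ z := funext (lineCLE_symm_apply z)

/-! ### Pieces of a local homeomorphism -/

variable {S : SchemeOver ℂ} {T : Type*} [TopologicalSpace T] {q : T → ComplexPoints S} (hq : IsLocalHomeomorph q)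

/-- A local inverse piece of `q` at `t`: an open partial homeomorphism agreeing with `q` as a function
and defined at `t` (Mathlib's `IsLocalHomeomorph`). [folklore] -/
def piece (t : T) : OpenPartialHomeomorph T (ComplexPoints S) := Classical.choose (hq t)

/-- `t` lies in the source of the piece of `q` at `t`. [folklore] -/
theorem mem_piece_source (t : T) : t ∈ (piece hq t).source := (Classical.choose_spec (hq t)).1

/-- The piece of `q` at `t` is `q` as a function. [folklore] -/
@[simp] theorem coe_piece (t : T) : ⇑(piece hq t) = q := (Classical.choose_spec (hq t)).2.symm

variable (S) [LocallyOfFiniteType S.hom] [SmoothOfRelativeDimension 1 S.hom]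

/-- The algebraic chart of `S(ℂ)` at `P`, read in `ℂ` (`algebraicChart S 1 P` followed by `ℂ¹ ≃ ℂ`).
[cite: SerreGAGA1956, §2 n°5 Prop. 2] -/
def algChart (P : ComplexPoints S) : OpenPartialHomeomorph (ComplexPoints S) ℂ :=
  (ComplexPoints.algebraicChart S 1 P).transHomeomorph lineCLE.toHomeomorph

/-- `P` lies in the source of its `ℂ`-valued algebraic chart. [folklore] -/
theorem mem_algChart_source (P : ComplexPoints S) : P ∈ (algChart S P).source := by
  rw [algChart, OpenPartialHomeomorph.transHomeomorph_source]
  exact ComplexPoints.mem_algebraicChart_source S 1 P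

/-- The source of the `ℂ`-valued algebraic chart is that of the algebraic chart. [folklore] -/
theorem algChart_source (P : ComplexPoints S) : (algChart S P).source = (ComplexPoints.algebraicChart S 1 P).source :=
  OpenPartialHomeomorph.transHomeomorph_source _ _

/-- The `ℂ`-valued algebraic chart is the (unique) coordinate of the algebraic chart. [folklore] -/
theorem algChart_apply (P Q : ComplexPoints S) : algChart S P Q = ComplexPoints.algebraicChart S 1 P Q 0 := by
  simp [algChart, OpenPartialHomeomorph.transHomeomorph_apply]

/-- The inverse of the `ℂ`-valued algebraic chart. [folklore] -/
theorem algChart_symm_apply (P : ComplexPoints S) (z : ℂ) :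
    (algChart S P).symm z = (ComplexPoints.algebraicChart S 1 P).symm (fun _ ↦ z) := by
  rw [algChart, OpenPartialHomeomorph.transHomeomorph_symm_apply, Function.comp_apply]
  show (ComplexPoints.algebraicChart S 1 P).symm (lineCLE.symm z) = _
  rw [lineCLE_symm_eq]

/-- The target of the `ℂ`-valued algebraic chart. [folklore] -/
theorem algChart_target (P : ComplexPoints S) :
    (algChart S P).target = (fun z : ℂ ↦ (fun _ : Fin 1 ↦ z)) ⁻¹' (ComplexPoints.algebraicChart S 1 P).target := by
  rw [algChart, OpenPartialHomeomorph.transHomeomorph_target]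
  ext z
  show lineCLE.symm z ∈ (ComplexPoints.algebraicChart S 1 P).target ↔
    (fun _ : Fin 1 ↦ z) ∈ (ComplexPoints.algebraicChart S 1 P).target
  rw [lineCLE_symm_eq]

/-- **Regular coordinates** of the `ℂ`-valued algebraic chart: on its source it is a regular function
on an affine open containing the source. [cite: SerreGAGA1956, §2 n°5 Prop. 2] -/
theorem algChart_alg (P : ComplexPoints S) :
    ∃ (U : S.left.affineOpens) (x : Γ(S.left, ↑U)), (algChart S P).source ⊆ {Q | Q.pt ∈ (↑U : S.left.Opens)} ∧
      ∀ Q ∈ (algChart S P).source, algChart S P Q = evalOrZero ↑U x Q := by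
  obtain ⟨⟨U, x, hsrc, hx⟩, -⟩ := ComplexPoints.algebraicChart_spec S 1 P
  refine ⟨U, x 0, by rwa [algChart_source], fun Q hQ ↦ ?_⟩
  rw [algChart_apply]
  exact hx Q (by rwa [algChart_source] at hQ) 0

/-- **Regular functions are holomorphic in the `ℂ`-valued algebraic chart.**
[cite: SerreGAGA1956, §2 n°5 Prop. 2] -/
theorem algChart_hol (P : ComplexPoints S) (U : S.left.affineOpens) (s : Γ(S.left, ↑U)) :
    ContDiffOn ℂ ω (evalOrZero ↑U s ∘ (algChart S P).symm)
      ((algChart S P).target ∩ (algChart S P).symm ⁻¹' {Q | Q.pt ∈ (↑U : S.left.Opens)}) := by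
  obtain ⟨-, hol⟩ := ComplexPoints.algebraicChart_spec S 1 P
  have hL : ContDiff ℂ ω (fun z : ℂ ↦ (fun _ : Fin 1 ↦ z)) := contDiff_pi.2 fun _ ↦ contDiff_id
  have hmaps : MapsTo (fun z : ℂ ↦ (fun _ : Fin 1 ↦ z))
      ((algChart S P).target ∩ (algChart S P).symm ⁻¹' {Q | Q.pt ∈ (↑U : S.left.Opens)})
      ((ComplexPoints.algebraicChart S 1 P).target ∩
        (ComplexPoints.algebraicChart S 1 P).symm ⁻¹' {Q | Q.pt ∈ (↑U : S.left.Opens)}) := by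
    rintro z ⟨hz, hz'⟩
    rw [algChart_target] at hz
    refine ⟨hz, ?_⟩
    rw [mem_preimage, algChart_symm_apply] at hz'
    exact hz'
  refine ((hol U s).comp hL.contDiffOn hmaps).congr fun z _ ↦ ?_
  show evalOrZero ↑U s ((algChart S P).symm z) = evalOrZero ↑U s ((ComplexPoints.algebraicChart S 1 P).symm (fun _ ↦ z))
  rw [algChart_symm_apply]

/-! ### The charts of `T` -/

variable {S}

variable (S) in
/-- **The chart of `T` at `t`**: the piece of `q` at `t` followed by the `ℂ`-valued algebraic chart
of `S(ℂ)` at `q t` (Forster, Thm. 1.13 / Thm. 4.6: pulling back the complex structure along a local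
homeomorphism). [cite: Forster1981, §1 Thm. 1.13] -/
def curveChart (t : T) : OpenPartialHomeomorph T ℂ := (piece hq t).trans (algChart S (q t))

/-- `t` lies in the source of the chart of `T` at `t`. [folklore] -/
theorem mem_curveChart_source (t : T) : t ∈ (curveChart S hq t).source := by
  rw [curveChart, OpenPartialHomeomorph.trans_source]
  refine ⟨mem_piece_source hq t, ?_⟩
  rw [mem_preimage, coe_piece]
  exact mem_algChart_source S (q t)

/-- The chart of `T` at `t` is the algebraic chart at `q t` composed with `q`. [folklore] -/
theorem curveChart_apply (t s : T) : curveChart S hq t s = algChart S (q t) (q s) := by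
  simp only [curveChart, OpenPartialHomeomorph.coe_trans, Function.comp_apply, coe_piece]

/-- The source of the chart of `T` at `t`. [folklore] -/
theorem curveChart_source (t : T) :
    (curveChart S hq t).source = (piece hq t).source ∩ q ⁻¹' (algChart S (q t)).source := by
  rw [curveChart, OpenPartialHomeomorph.trans_source, coe_piece]

/-- The target of the chart of `T` at `t` lies in the target of the algebraic chart at `q t`. [folklore] -/
theorem curveChart_target_subset (t : T) : (curveChart S hq t).target ⊆ (algChart S (q t)).target := by
  rw [curveChart, OpenPartialHomeomorph.trans_target]
  exact inter_subset_left

/-- **The chart formula**: `q ∘ (curveChart t)⁻¹ = (algChart (q t))⁻¹` on the target (the piece of `q`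
cancels against its inverse). [folklore] -/
theorem q_curveChart_symm {t : T} {z : ℂ} (hz : z ∈ (curveChart S hq t).target) :
    q ((curveChart S hq t).symm z) = (algChart S (q t)).symm z := by
  rw [curveChart, OpenPartialHomeomorph.trans_target] at hz
  simp only [curveChart, OpenPartialHomeomorph.trans_symm_eq_symm_trans_symm, OpenPartialHomeomorph.coe_trans,
    Function.comp_apply]
  have h := (piece hq t).right_inv hz.2
  rwa [coe_piece] at h

variable (S) in
/-- **The charted-space structure of `T` modelled on `ℂ`** (a `def`; install with `letI`).
[cite: Forster1981, §1 Thm. 1.13] -/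
@[reducible]
def chartedSpace : ChartedSpace ℂ T where
  atlas := range (curveChart S hq)
  chartAt := curveChart S hq
  mem_chart_source := mem_curveChart_source hq
  chart_mem_atlas t := mem_range_self t

/-- **`T` is a Riemann surface**: the charts `curveChart` are holomorphically compatible (a transition
map is a regular coordinate read in an algebraic chart). [cite: SerreGAGA1956, §2 n°5 Prop. 2]
[cite: Forster1981, §1 Thm. 1.13] -/
theorem isManifold : @IsManifold ℂ _ ℂ _ _ ℂ _ 𝓘(ℂ, ℂ) ω T _ (chartedSpace S hq) := by
  letI := chartedSpace S hq
  refine isManifold_of_contDiffOn _ _ _ ?_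
  rintro e e' ⟨t, rfl⟩ ⟨t', rfl⟩
  simp only [modelWithCornersSelf_coe, modelWithCornersSelf_coe_symm, range_id, inter_univ, preimage_id_eq, id_eq,
    comp_id, id_comp]
  obtain ⟨U', x', hsrc', hx'⟩ := algChart_alg S (q t')
  -- on the source of the transition map, it is `x'` read in the algebraic chart at `q t`
  have heq : ∀ z ∈ ((curveChart S hq t).symm.trans (curveChart S hq t')).source,
      ((curveChart S hq t).symm.trans (curveChart S hq t')) z = (evalOrZero ↑U' x' ∘ (algChart S (q t)).symm) z := by
    intro z hz
    rw [OpenPartialHomeomorph.trans_source, OpenPartialHomeomorph.symm_source] at hz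
    have h1 : q ((curveChart S hq t).symm z) ∈ (algChart S (q t')).source := by
      have h := hz.2
      rw [mem_preimage, curveChart_source] at h
      exact h.2
    simp only [OpenPartialHomeomorph.coe_trans, Function.comp_apply, curveChart_apply]
    rw [hx' _ h1, q_curveChart_symm hq hz.1]
  have hsub : ((curveChart S hq t).symm.trans (curveChart S hq t')).source ⊆
      (algChart S (q t)).target ∩ (algChart S (q t)).symm ⁻¹' {Q | Q.pt ∈ (↑U' : S.left.Opens)} := by
    intro z hz
    rw [OpenPartialHomeomorph.trans_source, OpenPartialHomeomorph.symm_source] at hz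
    refine ⟨curveChart_target_subset hq t hz.1, ?_⟩
    have h := hz.2
    rw [mem_preimage, curveChart_source] at h
    rw [mem_preimage, ← q_curveChart_symm hq hz.1]
    exact hsrc' h.2
  exact ((algChart_hol S (q t) U' x').mono hsub).congr heq

/-! ### Regular functions pulled back along `q` are holomorphic -/

/-- A regular function pulled back along `q`, read in the chart at `t`, is `C^ω` on the part of the
target over `U(ℂ)`. [cite: SerreGAGA1956, §2 n°5 Prop. 2] -/
theorem contDiffOn_evalOrZero_comp_symm (t : T) (U : S.left.affineOpens) (s : Γ(S.left, ↑U)) :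
    ContDiffOn ℂ ω (fun z ↦ evalOrZero ↑U s (q ((curveChart S hq t).symm z)))
      ((curveChart S hq t).target ∩ (curveChart S hq t).symm ⁻¹' (q ⁻¹' {Q | Q.pt ∈ (↑U : S.left.Opens)})) := by
  have hsub : (curveChart S hq t).target ∩ (curveChart S hq t).symm ⁻¹' (q ⁻¹' {Q | Q.pt ∈ (↑U : S.left.Opens)}) ⊆
      (algChart S (q t)).target ∩ (algChart S (q t)).symm ⁻¹' {Q | Q.pt ∈ (↑U : S.left.Opens)} := by
    rintro z ⟨hz, hz'⟩
    refine ⟨curveChart_target_subset hq t hz, ?_⟩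
    rw [mem_preimage, ← q_curveChart_symm hq hz]
    exact hz'
  refine ((algChart_hol S (q t) U s).mono hsub).congr fun z hz ↦ ?_
  simp only [Function.comp_apply, q_curveChart_symm hq hz.1]

/-- The set of the previous statement is an open neighbourhood of the image of `t` when `q t ∈ U(ℂ)`.
[folklore] -/
theorem isOpen_target_inter (t : T) (U : S.left.Opens) :
    IsOpen ((curveChart S hq t).target ∩ (curveChart S hq t).symm ⁻¹' (q ⁻¹' {Q | Q.pt ∈ U})) :=
  (curveChart S hq t).isOpen_inter_preimage_symm ((AlgPoints.isOpen_setOf_pt_mem U).preimage hq.continuous)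

/-- The image of `t` lies in the set of `isOpen_target_inter`. [folklore] -/
theorem mem_target_inter {t : T} {U : S.left.Opens} (ht : (q t).pt ∈ U) :
    curveChart S hq t t ∈ (curveChart S hq t).target ∩ (curveChart S hq t).symm ⁻¹' (q ⁻¹' {Q | Q.pt ∈ U}) := by
  refine ⟨(curveChart S hq t).map_source (mem_curveChart_source hq t), ?_⟩
  rw [mem_preimage, (curveChart S hq t).left_inv (mem_curveChart_source hq t)]
  exact ht

/-- **Regular functions pulled back along `q` are holomorphic on `T`** (for the charted space
`CurveCharts.chartedSpace`). [cite: SerreGAGA1956, §2 n°5 Prop. 2] -/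
theorem mdifferentiableAt_evalOrZero_comp (U : S.left.affineOpens) (s : Γ(S.left, ↑U)) {t : T}
    (ht : (q t).pt ∈ (↑U : S.left.Opens)) :
    letI := chartedSpace S hq
    MDifferentiableAt 𝓘(ℂ, ℂ) 𝓘(ℂ, ℂ) (fun t ↦ evalOrZero ↑U s (q t)) t := by
  letI := chartedSpace S hq
  haveI := isManifold (S := S) hq
  refine mdifferentiableAt_of_differentiableAt_comp_symm ?_
  have h := (contDiffOn_evalOrZero_comp_symm hq t U s).differentiableOn (by simp)
  exact h.differentiableAt ((isOpen_target_inter hq t ↑U).mem_nhds (mem_target_inter hq ht))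

/-! ### Absence of isolated points -/

omit [LocallyOfFiniteType S.hom] [SmoothOfRelativeDimension 1 S.hom] in
/-- **A space with `ℂ`-charts has no isolated points.** [folklore] -/
theorem neBot_nhdsNE {M : Type*} [TopologicalSpace M] [ChartedSpace ℂ M] (x : M) : (𝓝[≠] x).NeBot :=
  (Filter.NeBot.map inferInstance _).mono (tendsto_chartAt_symm_nhdsNE x)

end CurveCharts

end Literature.AlgebraicGeometry.FundamentalGroup
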